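import Summits.QuantumFields.YangMills.Theorems.PoincareLipschitzCovariantOneFormMeanValue
import Summits.QuantumFields.YangMills.Theorems.UnitScaleTiltProp7RieszTauFrobNormT3
import Literature.MathematicalPhysics.QuantumFieldTheory.Balaban1983to89.B9TorusCalculus
import Literature.MathematicalPhysics.QuantumFieldTheory.Balaban1983to89.B10Eq27TorusAxialLog
import HarnessLib

/-!
# Line «poincare_lipschitz» on crux `HistoryTailL` (stmt-QuantumFields-19936), route crux `BlockLipschitzL` (stmt-QuantumFields-23533), K2 supplier plan,
# (R3)-COV — «COV-BRIDGE»: THE COVARIANT ONE-FORM MEAN-VALUE ROW READ ON THE TORUS `T^{(j)}` FOR `M₂(ℂ)`-VALUED BOND FIELDS WITH A UNITARY BACKGROUND,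
# in the `B9Eq39Adjoint` letters (`covD`, `covDstar`, `curl`, `divB`, `plaqU` over `torusT`) and the cell's operator-norm currency — the instance of record
# `V = W₂` (Frobenius fibre), `τ = Ad(U)` of the (V, τ) covariant road, pulled back along `B10Eq27TorusAxialLog.transl x₀`

Cell `ym3-torus` (YM ladder rung R3 = continuum SU(2) Yang–Mills on the three-torus — a RUNG, NOT the Clay problem: not d = 4, not infinite volume, not a
mass gap); width seat `ym-ust-19936-w5` gen 11 (bus 2026-08-29T01:5xZ «COV-BRIDGE»; LEAD ym-ust-19936-w1 g7 card v1.29 (c) ∕ v1.30 «deep regime = covariant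
Campanato road + ALIGN»; px7 g4 01:50:19Z «what F6 displays is this row read on the torus through ★w5's COV-BRIDGE»).  THEOREMS ONLY (def-free);
`--supports stmt-QuantumFields-19936`.  Nothing here proves `hStab`, F6, a stub, `BlockLipschitzL`, `HistoryTailL` or a summit statement.

WHY.  The (V, τ) covariant road is kernel-complete on `ℤ^d` for an ABSTRACT real inner-product fibre `V` and a connection by linear isometries `τ`
(✓`PoincareLipschitzCovariantCaccioppoli`∕`…Kato`∕`…Dirichlet`∕`…DirichletSup`∕`…Antideriv`∕`…OneFormSource`∕`…SourcedMeanValue`∕`…OneFormMeanValue`, px7 g4 + ★w5 g11):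
★★`PoincareLipschitzCovariantOneFormMeanValue.normSq_le_of_cov_curl_div_hol` bounds `‖Y_μ(x₀)‖²` by `R^{−d}·Σ_{Q_R}‖Y_μ‖²` plus `R²·(κ + δ + R·θ·S)²` from the
covariant curl `κ`, covariant divergence `δ`, plaquette-holonomy defect `θ` and local sup `S`.  The K2 consumers (F6 = the re-gauged tower of ✓p686171 with the
(R3)-COV row per level; h⋆ ✓p683030) live on the tori `Site P j` with `M₂(ℂ)`-valued bond fields, `SU(2)` backgrounds and the `L²`-operator norm.  This file is
the dictionary: (i) `Ad(U)` on the Frobenius fibre `W₂ = ℂ^{2×2}` (✓`Prop7SectET3HilbertLetters.adW`, unitary ⇒ a REAL LINEAR ISOMETRY — built inside the proof with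
`InnerProductSpace.complexToReal`, never exposed), (ii) the pull-back along `transl x₀ : ℤ^d → Site P j` (additive ⇒ the covariant letters pull back EXACTLY,
no period hypothesis), (iii) operator norm ↔ Frobenius norm once at each end (`‖X‖ ≤ ‖frobEquiv⁻¹X‖ ≤ √2‖X‖`, ✓`Prop7RieszTauFrobNorm`), (iv) the plaquette
hypothesis from the operator-norm distance `‖U(∂p) − 1‖` (`‖Ad(U_p)v − v‖ ≤ 2√2·‖U_p − 1‖·‖v‖`).  Constants: the mass term doubles, `κ, δ, S ↦ √2·`, `θ ↦ 2√2·`.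

* §1 (fibre) `adW_inv_adW`, `adW_adW_inv`, `adW_mul`, ★`norm_adW` (`‖Ad(U)v‖ = ‖v‖` for `U⁻¹ = U*`), `frobEquiv_symm_conj`, `frobEquiv_symm_conj_inv`,
  `mem_unitary_coe_inv`, ★`norm_adW_sub_self_le` (`‖Ad(P)v − v‖ ≤ 2√2‖P − 1‖‖v‖`).
* §2 (torus) `transl_add_unitVec`, `transl_sub_unitVec`.
* §3 ★★★ `normSq_le_of_cov_curl_div_plaq_torus` — `d ≥ 1`, `R ≥ 4`, unitary background `U : Fin P.d → Site P j → M₂(ℂ)ˣ`, bond field `A : Fin P.d → Site P j → M₂(ℂ)`: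
  `‖curl U A ν μ‖ ≤ κ` on `transl x₀''Q_{R+1}`, `‖divB U A‖ ≤ δ` and `‖plaqU U μ ν − 1‖ ≤ θ` (`ν ≠ μ`) on `transl x₀''Q_{R+2}`, `‖A ν‖ ≤ S` on `transl x₀''Q_{R+3}` ⇒
  `‖A μ x₀‖² ≤ 8K·Σ_{w ∈ Q_R(0)}‖A μ (transl x₀ w)‖² + (4K(2R+1)^d + 2)·(64·2^d·d·(√2κ + √2δ + (2R+3)·(2√2θ·((d−1)·√2S)))·(2R+1))²`, `K = 16(336·d·2^d)^d∕R^d`.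
[folklore] ([Balaban1985BackgroundPropagators] (3.3), (3.8), (3.24)–(3.25) pp.391–394 for the letters; [Balaban1985Averaging] (18)–(20) p.21 for the two norms;
[Giaquinta1984] Ch. III §2 for the road).
-/

set_option autoImplicit false

noncomputable section

open scoped BigOperators InnerProductSpace ComplexConjugate Matrix.Norms.L2Operator
open Finset

namespace Summit.QuantumFields.YangMills.Theorems.PoincareLipschitzCovariantBridge

open Literature.MathematicalPhysics.QuantumFieldTheory.Balaban1983to89
open B4Eq19LatticeOperators
open B9Eq39Adjoint (R R_def covD covDstar curl divB plaqU)
open B9TorusCalculus (torusT torusT_apply torusT_symm_apply)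
open B10Eq27TorusAxialLog (transl transl_zero transl_add_e transl_sub_e)
open Summit.QuantumFields.YangMills.Theorems.Prop7SectET3HilbertLetters (W₂ frobEquiv adW frobEquiv_adW adW_apply inner_adW_left)
open Summit.QuantumFields.YangMills.Theorems.Prop7RieszTauFrobNorm (norm_le_norm_frobEquiv_symm norm_frobEquiv_symm_le norm_frobEquiv_le)
open Summit.QuantumFields.YangMills.Theorems.PoincareLipschitzCovariantOneFormMeanValue (normSq_le_of_cov_curl_div_hol)

/-! ## §1 The Frobenius fibre `W₂` and the transporters `Ad(U)` -/

/-- `Ad(U⁻¹)(Ad(U)v) = v`. [folklore] [cite: Balaban1985BackgroundPropagators, (3.3) p.391] -/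
theorem adW_inv_adW (U : (Matrix (Fin 2) (Fin 2) ℂ)ˣ) (v : W₂) : adW U⁻¹ (adW U v) = v := by
  apply frobEquiv.injective
  rw [frobEquiv_adW, frobEquiv_adW, inv_inv]
  simp only [← Matrix.mul_assoc, Units.inv_mul, Matrix.one_mul]
  rw [Matrix.mul_assoc, Units.inv_mul, Matrix.mul_one]

/-- `Ad(U)(Ad(U⁻¹)v) = v`. [folklore] [cite: Balaban1985BackgroundPropagators, (3.3) p.391] -/
theorem adW_adW_inv (U : (Matrix (Fin 2) (Fin 2) ℂ)ˣ) (v : W₂) : adW U (adW U⁻¹ v) = v := by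
  have := adW_inv_adW U⁻¹ v
  rwa [inv_inv] at this

/-- `Ad(PQ) = Ad(P) ∘ Ad(Q)`. [folklore] [cite: Balaban1985BackgroundPropagators, (3.3) p.391] -/
theorem adW_mul (P Q : (Matrix (Fin 2) (Fin 2) ℂ)ˣ) (v : W₂) : adW (P * Q) v = adW P (adW Q v) := by
  apply frobEquiv.injective
  rw [frobEquiv_adW, frobEquiv_adW, frobEquiv_adW, mul_inv_rev, Units.val_mul, Units.val_mul]
  simp only [Matrix.mul_assoc]

/-- ★ `Ad(U)` preserves the Frobenius norm when `U⁻¹ = U*`. [folklore] [cite: Balaban1985Averaging, (18) p.21] -/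
theorem norm_adW (U : (Matrix (Fin 2) (Fin 2) ℂ)ˣ) (hU : (((U⁻¹ : (Matrix (Fin 2) (Fin 2) ℂ)ˣ) : Matrix (Fin 2) (Fin 2) ℂ)) = star (U : Matrix (Fin 2) (Fin 2) ℂ))
    (v : W₂) : ‖adW U v‖ = ‖v‖ := by
  have h3 : ⟪adW U v, adW U v⟫_ℂ = ⟪v, v⟫_ℂ := by rw [inner_adW_left U hU, adW_inv_adW]
  have h4 : ‖adW U v‖ ^ 2 = ‖v‖ ^ 2 := by
    rw [@norm_sq_eq_re_inner ℂ, @norm_sq_eq_re_inner ℂ, h3]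
  exact (pow_left_inj₀ (norm_nonneg _) (norm_nonneg _) two_ne_zero).mp h4

/-- `frobEquiv⁻¹ (V M V⁻¹) = Ad(V)(frobEquiv⁻¹ M)`. [folklore] [cite: Balaban1985BackgroundPropagators, (3.3) p.391] -/
theorem frobEquiv_symm_conj (V : (Matrix (Fin 2) (Fin 2) ℂ)ˣ) (M : Matrix (Fin 2) (Fin 2) ℂ) :
    (frobEquiv.symm ((V : Matrix (Fin 2) (Fin 2) ℂ) * M * (((V⁻¹ : (Matrix (Fin 2) (Fin 2) ℂ)ˣ) : Matrix (Fin 2) (Fin 2) ℂ))) : W₂) =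
      adW V (frobEquiv.symm M) := (adW_apply V M).symm

/-- `frobEquiv⁻¹ (V⁻¹ M (V⁻¹)⁻¹) = Ad(V⁻¹)(frobEquiv⁻¹ M)` (the shape of `R (U⁻¹)` in `covDstar`). [folklore] [cite: Balaban1985BackgroundPropagators, (3.8) p.392] -/
theorem frobEquiv_symm_conj_inv (V : (Matrix (Fin 2) (Fin 2) ℂ)ˣ) (M : Matrix (Fin 2) (Fin 2) ℂ) :
    (frobEquiv.symm ((((V⁻¹ : (Matrix (Fin 2) (Fin 2) ℂ)ˣ) : Matrix (Fin 2) (Fin 2) ℂ)) * M *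
        ((((V⁻¹)⁻¹ : (Matrix (Fin 2) (Fin 2) ℂ)ˣ) : Matrix (Fin 2) (Fin 2) ℂ))) : W₂) = adW V⁻¹ (frobEquiv.symm M) :=
  (adW_apply V⁻¹ M).symm

/-- For `P⁻¹ = P*`, the inverse `P⁻¹` is a unitary element of the C⋆-algebra `M₂(ℂ)` (operator norm). [folklore] -/
theorem mem_unitary_coe_inv (P : (Matrix (Fin 2) (Fin 2) ℂ)ˣ) (hP : (((P⁻¹ : (Matrix (Fin 2) (Fin 2) ℂ)ˣ) : Matrix (Fin 2) (Fin 2) ℂ)) = star (P : Matrix (Fin 2) (Fin 2) ℂ)) :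
    (((P⁻¹ : (Matrix (Fin 2) (Fin 2) ℂ)ˣ) : Matrix (Fin 2) (Fin 2) ℂ)) ∈ unitary (Matrix (Fin 2) (Fin 2) ℂ) := by
  rw [Unitary.mem_iff, hP, star_star]
  refine ⟨?_, ?_⟩
  · rw [← hP]; exact P.mul_inv
  · rw [← hP]; exact P.inv_mul

/-- Products of `U⁻¹ = U*` units are `U⁻¹ = U*` units. [folklore] -/
theorem inv_eq_star_mul (P Q : (Matrix (Fin 2) (Fin 2) ℂ)ˣ) (hP : (((P⁻¹ : (Matrix (Fin 2) (Fin 2) ℂ)ˣ) : Matrix (Fin 2) (Fin 2) ℂ)) = star (P : Matrix (Fin 2) (Fin 2) ℂ))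
    (hQ : (((Q⁻¹ : (Matrix (Fin 2) (Fin 2) ℂ)ˣ) : Matrix (Fin 2) (Fin 2) ℂ)) = star (Q : Matrix (Fin 2) (Fin 2) ℂ)) :
    ((((P * Q)⁻¹ : (Matrix (Fin 2) (Fin 2) ℂ)ˣ) : Matrix (Fin 2) (Fin 2) ℂ)) = star ((P * Q : (Matrix (Fin 2) (Fin 2) ℂ)ˣ) : Matrix (Fin 2) (Fin 2) ℂ) := by
  rw [mul_inv_rev, Units.val_mul, Units.val_mul, hP, hQ, star_mul]

/-- Inverses of `U⁻¹ = U*` units are `U⁻¹ = U*` units. [folklore] -/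
theorem inv_eq_star_inv (P : (Matrix (Fin 2) (Fin 2) ℂ)ˣ) (hP : (((P⁻¹ : (Matrix (Fin 2) (Fin 2) ℂ)ˣ) : Matrix (Fin 2) (Fin 2) ℂ)) = star (P : Matrix (Fin 2) (Fin 2) ℂ)) :
    ((((P⁻¹)⁻¹ : (Matrix (Fin 2) (Fin 2) ℂ)ˣ) : Matrix (Fin 2) (Fin 2) ℂ)) = star (((P⁻¹ : (Matrix (Fin 2) (Fin 2) ℂ)ˣ) : Matrix (Fin 2) (Fin 2) ℂ)) := by
  rw [inv_inv, hP, star_star]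

/-- ★ **THE PLAQUETTE HYPOTHESIS FROM THE OPERATOR-NORM DISTANCE**: for `P⁻¹ = P*`, `‖Ad(P)v − v‖ ≤ 2√2·‖P − 1‖·‖v‖` on the Frobenius fibre
(`PXP⁻¹ − X = ((P−1)X − X(P−1))P⁻¹`, `‖P⁻¹‖ = 1`, `‖X‖ ≤ ‖frobEquiv⁻¹X‖ ≤ √2‖X‖`). [folklore] [cite: Balaban1985Averaging, (18)-(20) p.21] -/
theorem norm_adW_sub_self_le (P : (Matrix (Fin 2) (Fin 2) ℂ)ˣ) (hP : (((P⁻¹ : (Matrix (Fin 2) (Fin 2) ℂ)ˣ) : Matrix (Fin 2) (Fin 2) ℂ)) = star (P : Matrix (Fin 2) (Fin 2) ℂ))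
    (v : W₂) : ‖adW P v - v‖ ≤ 2 * Real.sqrt 2 * ‖(P : Matrix (Fin 2) (Fin 2) ℂ) - 1‖ * ‖v‖ := by
  obtain ⟨X, rfl⟩ : ∃ X, v = frobEquiv.symm X := ⟨frobEquiv v, (LinearEquiv.symm_apply_apply _ _).symm⟩
  set Pm : Matrix (Fin 2) (Fin 2) ℂ := (P : Matrix (Fin 2) (Fin 2) ℂ) with hPm
  set Pi : Matrix (Fin 2) (Fin 2) ℂ := ((P⁻¹ : (Matrix (Fin 2) (Fin 2) ℂ)ˣ) : Matrix (Fin 2) (Fin 2) ℂ) with hPi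
  have hid : adW P (frobEquiv.symm X) - frobEquiv.symm X = frobEquiv.symm (((Pm - 1) * X - X * (Pm - 1)) * Pi) := by
    rw [adW_apply, ← map_sub]
    congr 1
    have hPP : Pm * Pi = 1 := by rw [hPm, hPi]; exact P.mul_inv
    calc Pm * X * Pi - X = Pm * X * Pi - X * (Pm * Pi) := by rw [hPP, Matrix.mul_one]
      _ = ((Pm - 1) * X - X * (Pm - 1)) * Pi := by noncomm_ring
  have hPi1 : ‖Pi‖ = 1 := CStarRing.norm_of_mem_unitary (mem_unitary_coe_inv P hP)
  have hX : ‖X‖ ≤ ‖(frobEquiv.symm X : W₂)‖ := norm_le_norm_frobEquiv_symm X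
  rw [hid]
  calc ‖(frobEquiv.symm (((Pm - 1) * X - X * (Pm - 1)) * Pi) : W₂)‖ ≤ Real.sqrt 2 * ‖((Pm - 1) * X - X * (Pm - 1)) * Pi‖ := norm_frobEquiv_symm_le _
    _ ≤ Real.sqrt 2 * ((‖Pm - 1‖ * ‖X‖ + ‖X‖ * ‖Pm - 1‖) * ‖Pi‖) := by
        refine mul_le_mul_of_nonneg_left ((norm_mul_le _ _).trans (mul_le_mul_of_nonneg_right ?_ (norm_nonneg _))) (Real.sqrt_nonneg _)
        exact (norm_sub_le _ _).trans (add_le_add (norm_mul_le _ _) (norm_mul_le _ _))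
    _ = 2 * Real.sqrt 2 * ‖Pm - 1‖ * ‖X‖ := by rw [hPi1]; ring
    _ ≤ 2 * Real.sqrt 2 * ‖Pm - 1‖ * ‖(frobEquiv.symm X : W₂)‖ := mul_le_mul_of_nonneg_left hX (by positivity)

/-! ## §2 The torus dictionary -/

section Torus

variable {P : Params} {j : ℕ}

/-- `transl x₀ (z + e_μ) = (transl x₀ z) + e_μ` with the road's `unitVec`. [folklore] [cite: Balaban1987RG1, (0.1) p.251] -/
theorem transl_add_unitVec (x₀ : Site P j) (z : Zd P.d) (μ : Fin P.d) : transl x₀ (z + unitVec μ) = (transl x₀ z).shift μ := by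
  have : (unitVec μ : Zd P.d) = B7Prop1Explicit.e μ := rfl
  rw [this, transl_add_e]

/-- `transl x₀ (z − e_μ) = (transl x₀ z) − e_μ` with the road's `unitVec`. [folklore] [cite: Balaban1987RG1, (0.1) p.251] -/
theorem transl_sub_unitVec (x₀ : Site P j) (z : Zd P.d) (μ : Fin P.d) : transl x₀ (z - unitVec μ) = (transl x₀ z).unshift μ := by
  have : (unitVec μ : Zd P.d) = B7Prop1Explicit.e μ := rfl
  rw [this, transl_sub_e]

/-! ## §3 The covariant one-form mean-value row on the torus, operator norm -/

/-- ★★★ **THE (R3)-COV ROW ON THE TORUS `T^{(j)}`, OPERATOR NORM, UNITARY BACKGROUND.**  `d ≥ 1`, `R ≥ 4`; `U : Fin P.d → Site P j → M₂(ℂ)ˣ` with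
`U⁻¹ = U*` bondwise; `A : Fin P.d → Site P j → M₂(ℂ)` a bond field; `x₀` a site; `μ` a direction; read along the periodic pull-back `transl x₀ : ℤ^d → Site P j`:
if `‖curl U A ν μ‖ ≤ κ` at the sites `transl x₀ w`, `w ∈ Q_{R+1}(0)`; `‖divB U A‖ ≤ δ` and, for `ν ≠ μ`, `‖U(∂p_{μν}) − 1‖ ≤ θ` at `transl x₀ w`, `w ∈ Q_{R+2}(0)`;
and `‖A ν‖ ≤ S` at `transl x₀ w`, `w ∈ Q_{R+3}(0)` — then
`‖A μ x₀‖² ≤ 8K·Σ_{w ∈ Q_R(0)} ‖A μ (transl x₀ w)‖² + (4K(2R+1)^d + 2)·(64·2^d·d·(√2κ + √2δ + (2(R+1)+1)·(2√2θ·((d−1)·√2S)))·(2R+1))²`, `K = 16(336·d·2^d)^d∕R^d`.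
Proof: ✓`normSq_le_of_cov_curl_div_hol` at `V := W₂` (Frobenius fibre, `InnerProductSpace.complexToReal`), `τ ν w := Ad(U ν (transl x₀ w))` (a real linear
isometry by `norm_adW`), `Y w ν := frobEquiv⁻¹(A ν (transl x₀ w))`; the covariant letters pull back exactly (`adW_apply`, `adW_mul`, `transl_add_unitVec`,
`transl_sub_unitVec`), and the two norms are compared once at each end.  NO smallness of the links; the background enters only through `θ`.
[folklore] [cite: Balaban1985BackgroundPropagators, (3.3), (3.8), (3.24)-(3.25) pp.391-394; Balaban1984PropagatorsII, (1.9) p.226] -/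
theorem normSq_le_of_cov_curl_div_plaq_torus (hd : 1 ≤ P.d) (U : Fin P.d → Site P j → (Matrix (Fin 2) (Fin 2) ℂ)ˣ)
    (hU : ∀ (ν : Fin P.d) (x : Site P j), ((((U ν x)⁻¹ : (Matrix (Fin 2) (Fin 2) ℂ)ˣ) : Matrix (Fin 2) (Fin 2) ℂ)) = star (U ν x : Matrix (Fin 2) (Fin 2) ℂ))
    (A : Fin P.d → Site P j → Matrix (Fin 2) (Fin 2) ℂ) (x₀ : Site P j) {R : ℤ} (hR : 4 ≤ R) (μ : Fin P.d) {κ δ θ S : ℝ}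
    (hκ0 : 0 ≤ κ) (hδ0 : 0 ≤ δ) (hθ0 : 0 ≤ θ) (hS0 : 0 ≤ S)
    (hcurl : ∀ w ∈ box (0 : Zd P.d) (R + 1), ∀ ν : Fin P.d, ‖curl (torusT P j) U A ν μ (transl x₀ w)‖ ≤ κ)
    (hdiv : ∀ w ∈ box (0 : Zd P.d) (R + 2), ‖divB (torusT P j) U A (transl x₀ w)‖ ≤ δ)
    (hplaq : ∀ w ∈ box (0 : Zd P.d) (R + 2), ∀ ν : Fin P.d, ν ≠ μ →
      ‖((plaqU (torusT P j) U μ ν (transl x₀ w) : (Matrix (Fin 2) (Fin 2) ℂ)ˣ) : Matrix (Fin 2) (Fin 2) ℂ) - 1‖ ≤ θ)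
    (hS : ∀ w ∈ box (0 : Zd P.d) (R + 3), ∀ ν : Fin P.d, ‖A ν (transl x₀ w)‖ ≤ S) :
    ‖A μ x₀‖ ^ 2 ≤ 8 * (16 * (336 * (P.d : ℝ) * (2 : ℝ) ^ P.d) ^ P.d / (R : ℝ) ^ P.d) * ∑ w ∈ box (0 : Zd P.d) R, ‖A μ (transl x₀ w)‖ ^ 2 +
      (4 * (16 * (336 * (P.d : ℝ) * (2 : ℝ) ^ P.d) ^ P.d / (R : ℝ) ^ P.d) * (2 * (R : ℝ) + 1) ^ P.d + 2) *
        (64 * (2 : ℝ) ^ P.d * P.d * (Real.sqrt 2 * κ + Real.sqrt 2 * δ +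
          (2 * ((R : ℝ) + 1) + 1) * ((2 * Real.sqrt 2 * θ) * (((P.d : ℝ) - 1) * (Real.sqrt 2 * S)))) * (2 * (R : ℝ) + 1)) ^ 2 := by
  classical
  letI : InnerProductSpace ℝ W₂ := InnerProductSpace.complexToReal
  -- the transports `Ad(U ν (x₀ + w))` as real linear isometries of the Frobenius fibre
  let τ : Fin P.d → Zd P.d → (W₂ ≃ₗᵢ[ℝ] W₂) := fun ν w =>
    { toFun := adW (U ν (transl x₀ w))
      invFun := adW (U ν (transl x₀ w))⁻¹
      map_add' := fun v v' => map_add (adW (U ν (transl x₀ w))) v v'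
      map_smul' := fun (c : ℝ) v => by
        show adW (U ν (transl x₀ w)) ((c : ℂ) • v) = (c : ℂ) • adW (U ν (transl x₀ w)) v
        exact map_smul (adW (U ν (transl x₀ w))) (c : ℂ) v
      left_inv := fun v => adW_inv_adW (U ν (transl x₀ w)) v
      right_inv := fun v => adW_adW_inv (U ν (transl x₀ w)) v
      norm_map' := fun v => norm_adW (U ν (transl x₀ w)) (hU ν (transl x₀ w)) v }
  have hτ : ∀ (ν : Fin P.d) (w : Zd P.d) (v : W₂), τ ν w v = adW (U ν (transl x₀ w)) v := fun _ _ _ => rfl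
  have hτs : ∀ (ν : Fin P.d) (w : Zd P.d) (v : W₂), (τ ν w).symm v = adW (U ν (transl x₀ w))⁻¹ v := fun _ _ _ => rfl
  -- the pulled-back bond field on the fibre
  let Y : Zd P.d → Fin P.d → W₂ := fun w ν => frobEquiv.symm (A ν (transl x₀ w))
  have hY : ∀ (w : Zd P.d) (ν : Fin P.d), Y w ν = frobEquiv.symm (A ν (transl x₀ w)) := fun _ _ => rfl
  have hs2 : (0 : ℝ) ≤ Real.sqrt 2 := Real.sqrt_nonneg _
  -- box bookkeeping
  have hbox1 : ∀ {y : Zd P.d}, y ∈ box (0 : Zd P.d) (R + 1) → ∀ ν, y + unitVec ν ∈ box (0 : Zd P.d) (R + 2) := fun hy ν => by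
    have := add_unitVec_mem_box hy ν; rwa [show R + 1 + 1 = R + 2 by ring] at this
  have hbox2 : ∀ {y : Zd P.d}, y ∈ box (0 : Zd P.d) (R + 1) → ∀ ν, y - unitVec ν ∈ box (0 : Zd P.d) (R + 2) := fun hy ν => by
    have := sub_unitVec_mem_box hy ν; rwa [show R + 1 + 1 = R + 2 by ring] at this
  have hbox3 : ∀ {y : Zd P.d}, y ∈ box (0 : Zd P.d) (R + 1) → ∀ ν μ', y - unitVec ν + unitVec μ' ∈ box (0 : Zd P.d) (R + 3) := fun hy ν μ' => by
    have := add_unitVec_mem_box (hbox2 hy ν) μ'; rwa [show R + 2 + 1 = R + 3 by ring] at this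
  -- (curl) the covariant curl pulls back exactly
  have hcurl' : ∀ y ∈ box (0 : Zd P.d) (R + 1), ∀ ν : Fin P.d,
      ‖(τ ν y (Y (y + unitVec ν) μ) - Y y μ) - (τ μ y (Y (y + unitVec μ) ν) - Y y ν)‖ ≤ Real.sqrt 2 * κ := by
    intro y hy ν
    have e : (τ ν y (Y (y + unitVec ν) μ) - Y y μ) - (τ μ y (Y (y + unitVec μ) ν) - Y y ν) =
        frobEquiv.symm (curl (torusT P j) U A ν μ (transl x₀ y)) := by
      rw [hτ, hτ, hY, hY, hY, hY, transl_add_unitVec, transl_add_unitVec, ← frobEquiv_symm_conj, ← frobEquiv_symm_conj]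
      simp only [curl, covD, R_def, torusT_apply, map_sub]
    rw [e]
    exact (norm_frobEquiv_symm_le _).trans (mul_le_mul_of_nonneg_left (hcurl y hy ν) hs2)
  -- (div) the covariant divergence pulls back exactly
  have hdiv' : ∀ y ∈ box (0 : Zd P.d) (R + 1),
      ‖∑ ν, ((τ ν (y + unitVec μ - unitVec ν)).symm (Y (y + unitVec μ - unitVec ν) ν) - Y (y + unitVec μ) ν)‖ ≤ Real.sqrt 2 * δ := by
    intro y hy
    have e : ∑ ν, ((τ ν (y + unitVec μ - unitVec ν)).symm (Y (y + unitVec μ - unitVec ν) ν) - Y (y + unitVec μ) ν) =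
        frobEquiv.symm (divB (torusT P j) U A (transl x₀ (y + unitVec μ))) := by
      simp only [divB, covDstar, R_def, torusT_symm_apply, map_sum, map_sub]
      refine Finset.sum_congr rfl fun ν _ => ?_
      rw [hτs, hY, hY, transl_sub_unitVec, ← frobEquiv_symm_conj_inv]
    rw [e]
    exact (norm_frobEquiv_symm_le _).trans (mul_le_mul_of_nonneg_left (hdiv _ (hbox1 hy μ)) hs2)
  -- (hol) the plaquette holonomy of the transports is `Ad(U(∂p))`
  have hHol' : ∀ y ∈ box (0 : Zd P.d) (R + 1), ∀ ν : Fin P.d, ν ≠ μ → ∀ v : W₂,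
      ‖τ μ (y - unitVec ν) (τ ν (y - unitVec ν + unitVec μ) ((τ μ y).symm ((τ ν (y - unitVec ν)).symm v))) - v‖ ≤ (2 * Real.sqrt 2 * θ) * ‖v‖ := by
    intro y hy ν hν v
    have hx : transl x₀ y = (transl x₀ (y - unitVec ν)).shift ν := by rw [← transl_add_unitVec, sub_add_cancel]
    have e : τ μ (y - unitVec ν) (τ ν (y - unitVec ν + unitVec μ) ((τ μ y).symm ((τ ν (y - unitVec ν)).symm v))) =
        adW (plaqU (torusT P j) U μ ν (transl x₀ (y - unitVec ν))) v := by
      rw [hτ, hτ, hτs, hτs, ← adW_mul, ← adW_mul, ← adW_mul, transl_add_unitVec, hx]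
      simp only [plaqU, torusT_apply]
    rw [e]
    have hPl : ((((plaqU (torusT P j) U μ ν (transl x₀ (y - unitVec ν)))⁻¹ : (Matrix (Fin 2) (Fin 2) ℂ)ˣ) : Matrix (Fin 2) (Fin 2) ℂ)) =
        star ((plaqU (torusT P j) U μ ν (transl x₀ (y - unitVec ν)) : (Matrix (Fin 2) (Fin 2) ℂ)ˣ) : Matrix (Fin 2) (Fin 2) ℂ) := by
      simp only [plaqU]
      exact inv_eq_star_mul _ _ (inv_eq_star_mul _ _ (inv_eq_star_mul _ _ (hU _ _) (hU _ _)) (inv_eq_star_inv _ (hU _ _)))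
        (inv_eq_star_inv _ (hU _ _))
    calc ‖adW (plaqU (torusT P j) U μ ν (transl x₀ (y - unitVec ν))) v - v‖
        ≤ 2 * Real.sqrt 2 * ‖((plaqU (torusT P j) U μ ν (transl x₀ (y - unitVec ν)) : (Matrix (Fin 2) (Fin 2) ℂ)ˣ) : Matrix (Fin 2) (Fin 2) ℂ) - 1‖ * ‖v‖ :=
          norm_adW_sub_self_le _ hPl v
      _ ≤ 2 * Real.sqrt 2 * θ * ‖v‖ :=
          mul_le_mul_of_nonneg_right (mul_le_mul_of_nonneg_left (hplaq _ (hbox2 hy ν) ν hν) (by positivity)) (norm_nonneg _)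
  -- (sup) the local sup pulls back with the factor `√2`
  have hS' : ∀ y ∈ box (0 : Zd P.d) (R + 1), ∀ ν : Fin P.d, ν ≠ μ → ‖Y (y - unitVec ν + unitVec μ) ν‖ ≤ Real.sqrt 2 * S := by
    intro y hy ν _
    rw [hY]
    exact (norm_frobEquiv_symm_le _).trans (mul_le_mul_of_nonneg_left (hS _ (hbox3 hy ν μ) ν) hs2)
  -- the (V, τ) row
  have main := normSq_le_of_cov_curl_div_hol (V := W₂) hd τ Y 0 hR μ (mul_nonneg hs2 hκ0) (mul_nonneg hs2 hδ0) (by positivity : 0 ≤ 2 * Real.sqrt 2 * θ)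
    (mul_nonneg hs2 hS0) hcurl' hdiv' hHol' hS'
  -- read the two ends in the operator norm
  have hL : ‖A μ x₀‖ ^ 2 ≤ ‖Y 0 μ‖ ^ 2 := by
    rw [hY, transl_zero]
    exact pow_le_pow_left₀ (norm_nonneg _) (norm_le_norm_frobEquiv_symm _) 2
  have hM : ∑ y ∈ box (0 : Zd P.d) R, ‖Y y μ‖ ^ 2 ≤ 2 * ∑ w ∈ box (0 : Zd P.d) R, ‖A μ (transl x₀ w)‖ ^ 2 := by
    rw [Finset.mul_sum]
    refine Finset.sum_le_sum fun w _ => ?_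
    rw [hY]
    have h := norm_frobEquiv_symm_le (A μ (transl x₀ w))
    have h2 : ‖(frobEquiv.symm (A μ (transl x₀ w)) : W₂)‖ ^ 2 ≤ (Real.sqrt 2 * ‖A μ (transl x₀ w)‖) ^ 2 := pow_le_pow_left₀ (norm_nonneg _) h 2
    rw [mul_pow, Real.sq_sqrt (by norm_num : (0 : ℝ) ≤ 2)] at h2
    exact h2
  have hK : 0 ≤ 4 * (16 * (336 * (P.d : ℝ) * (2 : ℝ) ^ P.d) ^ P.d / (R : ℝ) ^ P.d) := by
    have hR0 : (0 : ℝ) ≤ R := by exact_mod_cast (show (0 : ℤ) ≤ R by linarith)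
    positivity
  calc ‖A μ x₀‖ ^ 2 ≤ ‖Y 0 μ‖ ^ 2 := hL
    _ ≤ _ := main
    _ ≤ _ := by
        have := mul_le_mul_of_nonneg_left hM hK
        nlinarith [this]

end Torus

end Summit.QuantumFields.YangMills.Theorems.PoincareLipschitzCovariantBridge

end
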